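import Summits.HubbardSuperconductivity.HubbardSuperconductivity.Theorems.InfiniteVolumeFirstCoarseTightnessDeviationBlocks
import Literature.MathematicalPhysics.QuantumLattice.FreeFermionSectorEnergyDeviation
import HarnessLib

/-!
# Coarse tightness programme — the LOCAL kinetic budget, II: summing over the translates

Continuation of `…CoarseTightnessDeviationBlocks` (same notation). Summing the block bathtub
inequality over all `L²` corners `a` and both spins, the block hopping terms add up to `R(R-1)` copies
of the torus hopping term and the block numbers to `R²` copies of the particle number
(`BlockKineticSum`), so that for a normalised `(2n, 0)`-sector ground state `ψ` of
`hubbardTorus 2 L 1 U`, `0 ≤ U`, `1 ≤ R`, `2R + 2 ≤ L`: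

  `Σ_a Σ_σ Σ_j |ε_j - μ| x^{aσ}_j (1 - x^{aσ}_j) ≤ 2[R(R-1) G_L(μ) - L² G_R(μ)] - 2μ n R + R(R-1) U L²`

for the (clamped) torus Fermi level `μ ∈ [-4,4]` (`deviation_sum_le_raw`: the tree's first-order budget
`Re⟨ψ,H₀ψ⟩ ≤ 2Σ_{k∈F}ε_L(k) + U L²` and the exact cancellation of the chemical-potential terms), and the
discrete block-vs-torus comparison of the grand-canonical band sums (`DirichletBlockLevels`,
`TorusBandRefinement`) turns the bracket into `O(L² R)`:

  **`deviationBudget`**: `∃ μ ∈ [-4,4], Σ_a Σ_σ Σ_j |ε_j - μ| x^{aσ}_j(1 - x^{aσ}_j) ≤ L² R² (U + (72 + 32π)/R)`.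

No definition and no named fact is introduced.
-/

noncomputable section

set_option linter.dupNamespace false

namespace Summit.HubbardSuperconductivity.HubbardSuperconductivity.Theorems.CoarseTightness

open Literature.MathematicalPhysics.QuantumLattice Literature.Probability.LatticeModels Matrix Finset
open Literature.MathematicalPhysics.QuantumLattice.RayleighBound
open scoped ComplexConjugate ComplexOrder

/-! ### Real arithmetic: the block-vs-torus comparison of the grand-canonical sums -/

/-- From `G^T ≤ 4 G_blk` (four-fold level embedding), the refinement comparison
`G_L/L² - 8π/L - 8π/(2R+2) ≤ G^T/(2R+2)²` and `|G_L| ≤ 8L²`: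
`R(R-1) G_L - L² G_blk ≤ (32 + 16π) L² R` (`1 ≤ R`, `2R + 2 ≤ L`). [folklore] -/
theorem budget_arith {R L Gt GT Gb : ℝ} (hR : 1 ≤ R) (hRL : 2 * R + 2 ≤ L) (h1 : GT ≤ 4 * Gb)
    (h2 : Gt / L ^ 2 - 8 * Real.pi / L - 8 * Real.pi / (2 * R + 2) ≤ GT / (2 * R + 2) ^ 2)
    (h3 : |Gt| ≤ 8 * L ^ 2) :
    R * (R - 1) * Gt - L ^ 2 * Gb ≤ (32 + 16 * Real.pi) * L ^ 2 * R := by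
  have hL : 0 < L := by linarith
  have hR1 : 0 < 2 * R + 2 := by linarith
  have hpi : 0 < Real.pi := Real.pi_pos
  -- clear denominators in `h2`
  have h2' : (2 * R + 2) ^ 2 * Gt - 8 * Real.pi * L * (2 * R + 2) ^ 2 - 8 * Real.pi * L ^ 2 * (2 * R + 2)
      ≤ L ^ 2 * GT := by
    have h := mul_le_mul_of_nonneg_left h2 (by positivity : (0 : ℝ) ≤ L ^ 2 * (2 * R + 2) ^ 2)
    have e1 : L ^ 2 * (2 * R + 2) ^ 2 * (Gt / L ^ 2 - 8 * Real.pi / L - 8 * Real.pi / (2 * R + 2)) =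
        (2 * R + 2) ^ 2 * Gt - 8 * Real.pi * L * (2 * R + 2) ^ 2 - 8 * Real.pi * L ^ 2 * (2 * R + 2) := by
      field_simp
    have e2 : L ^ 2 * (2 * R + 2) ^ 2 * (GT / (2 * R + 2) ^ 2) = L ^ 2 * GT := by
      field_simp
    linarith [h, e1, e2]
  -- `L² G_blk ≥ L² G^T / 4`
  have h1' : L ^ 2 * GT ≤ 4 * (L ^ 2 * Gb) := by nlinarith [sq_nonneg L]
  have hGt := abs_le.1 h3
  -- bookkeeping of the error terms under `R + 1 ≤ L/2`, `R + 1 ≤ 2R`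
  nlinarith [mul_nonneg hpi.le hL.le, mul_nonneg (mul_nonneg hpi.le hL.le) (by linarith : (0:ℝ) ≤ R),
    mul_nonneg (mul_nonneg hpi.le hL.le) hL.le, hGt.1, hGt.2,
    mul_nonneg (by linarith : (0:ℝ) ≤ R) (sq_nonneg L), sq_nonneg L,
    mul_nonneg (by linarith : (0:ℝ) ≤ R - 1) (sq_nonneg L)]

/-! ### The Fermi energy through the grand-canonical sum -/

/-- For a Fermi set `F` (levels `≤ μ` inside, `≥ μ` outside):
`Σ_{k ∈ F} ε_k = Σ_k min(ε_k - μ, 0) + μ |F|`. [folklore] -/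
theorem sum_fermiSet_eq_gcSum_add {ι : Type*} [Fintype ι] [DecidableEq ι] (ε : ι → ℝ) (F : Finset ι)
    (μ : ℝ) (hF : ∀ k ∈ F, ε k ≤ μ) (hF' : ∀ k ∉ F, μ ≤ ε k) :
    ∑ k ∈ F, ε k = ∑ k, min (ε k - μ) 0 + μ * F.card := by
  have hsplit : ∑ k, min (ε k - μ) 0 = ∑ k ∈ F, min (ε k - μ) 0 + ∑ k ∈ Finset.univ \ F, min (ε k - μ) 0 := by
    rw [← Finset.sum_sdiff (Finset.subset_univ F), add_comm]
  have hin : ∑ k ∈ F, min (ε k - μ) 0 = ∑ k ∈ F, (ε k - μ) :=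
    Finset.sum_congr rfl fun k hk => min_eq_left (by linarith [hF k hk])
  have hout : ∑ k ∈ Finset.univ \ F, min (ε k - μ) 0 = 0 :=
    Finset.sum_eq_zero fun k hk => min_eq_right (by
      have := hF' k (Finset.mem_sdiff.1 hk).2; linarith)
  rw [hsplit, hin, hout, add_zero, Finset.sum_sub_distrib, Finset.sum_const, nsmul_eq_mul]
  ring

/-- A Fermi level can be clamped to the band `[-4, 4]`. [folklore] -/
theorem exists_clamped_fermiLevel {L : ℕ} [NeZero L] (F : Finset (TorusSite 2 L)) (eF : ℝ)
    (hF : ∀ k ∈ F, torusBand L k ≤ eF) (hF' : ∀ k ∉ F, eF ≤ torusBand L k) :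
    ∃ μ ∈ Set.Icc (-4 : ℝ) 4, (∀ k ∈ F, torusBand L k ≤ μ) ∧ (∀ k ∉ F, μ ≤ torusBand L k) := by
  refine ⟨max (-4) (min 4 eF), ⟨le_max_left _ _, max_le (by norm_num) (min_le_left _ _)⟩, ?_, ?_⟩
  · intro k hk
    exact le_max_of_le_right (le_min (torusBand_le_four L k) (hF k hk))
  · intro k hk
    exact max_le (neg_four_le_torusBand L k) ((min_le_right _ _).trans (hF' k hk))

/-- Abstract summation step: from the per-block inequalities `G + μ N(a,s) + D(a,s) ≤ -T(a,s)`,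
`Σ_a Σ_s D ≤ -(Σ_s Σ_a T) - |A||S| G - μ Σ_s Σ_a N`. [folklore] -/
theorem sum_budget_abstract {A S : Type*} [Fintype A] [Fintype S] (G μ : ℝ) (N D T : A → S → ℝ)
    (h : ∀ a s, G + μ * N a s + D a s ≤ -T a s) :
    ∑ a, ∑ s, D a s ≤
      -(∑ s, ∑ a, T a s) - (Fintype.card A : ℝ) * (Fintype.card S : ℝ) * G - μ * ∑ s, ∑ a, N a s := by
  have hsum : ∑ a, ∑ s, (G + μ * N a s + D a s) ≤ ∑ a, ∑ s, (-T a s) :=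
    Finset.sum_le_sum fun a _ => Finset.sum_le_sum fun s _ => h a s
  have e1 : ∑ a, ∑ s, (G + μ * N a s + D a s) =
      (Fintype.card A : ℝ) * (Fintype.card S : ℝ) * G + μ * ∑ s, ∑ a, N a s + ∑ a, ∑ s, D a s := by
    simp only [Finset.sum_add_distrib, Finset.sum_const, Finset.card_univ, nsmul_eq_mul, ← Finset.mul_sum]
    rw [Finset.sum_comm (f := fun a s => N a s)]
    ring
  have e2 : ∑ a, ∑ s, (-T a s) = -(∑ s, ∑ a, T a s) := by
    rw [Finset.sum_comm]
    simp only [Finset.sum_neg_distrib]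
  linarith

/-! ### Summing the block bathtub inequalities over the translates -/

section Sum

open Classical

variable {L : ℕ} [NeZero L]

/-- Sector bookkeeping: `Σ_x Re ⟨ψ, n_{xσ} ψ⟩ = n` on `szSector (2n) 0` for a unit `ψ`, the sites
parametrised by the statistical-mechanics torus. [folklore] -/
theorem sum_re_expect_numberOp_ofTorusSite {n : ℕ} {ψ : Fock (Orb (FermionTorus 2 L))}
    (hψ : ψ ∈ szSector (Λ := FermionTorus 2 L) (2 * n) 0) (h1 : star ψ ⬝ᵥ ψ = 1) (σ : Fin 2) :
    ∑ x : TorusSite 2 L, (star ψ ⬝ᵥ ((numberOp (FermionTorus.ofTorusSite x) σ :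
        Matrix (Finset (Orb (FermionTorus 2 L))) _ ℂ) *ᵥ ψ)).re = n := by
  have hsec : IsInSector n n ψ := (mem_szSector_two_mul_zero_iff n ψ).1 hψ
  have hre1 : (star ψ ⬝ᵥ ψ).re = 1 := by rw [h1, Complex.one_re]
  -- pass to the fermionic torus and then to momentum space
  have hconv : ∑ x : TorusSite 2 L, (star ψ ⬝ᵥ ((numberOp (FermionTorus.ofTorusSite x) σ :
      Matrix (Finset (Orb (FermionTorus 2 L))) _ ℂ) *ᵥ ψ)).re =
      ∑ X : FermionTorus 2 L, (star ψ ⬝ᵥ ((numberOp X σ :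
        Matrix (Finset (Orb (FermionTorus 2 L))) _ ℂ) *ᵥ ψ)).re :=
    Fintype.sum_equiv (FermionTorus.equivTorusSite (d := 2) (L := L)).symm _ _ fun x => rfl
  have hop : (∑ X : FermionTorus 2 L, (numberOp X σ : Matrix (Finset (Orb (FermionTorus 2 L))) _ ℂ)) =
      ∑ k : TorusSite 2 L, momentumNumber k σ := (sum_momentumNumber_eq_sum_numberOp σ).symm
  have hsum : ∑ X : FermionTorus 2 L, (star ψ ⬝ᵥ ((numberOp X σ :
      Matrix (Finset (Orb (FermionTorus 2 L))) _ ℂ) *ᵥ ψ)).re =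
      ∑ k : TorusSite 2 L, (star ψ ⬝ᵥ (momentumNumber k σ *ᵥ ψ)).re := by
    rw [← Complex.re_sum, ← dotProduct_sum, ← Matrix.sum_mulVec, hop, Matrix.sum_mulVec, dotProduct_sum,
      Complex.re_sum]
  rw [hconv, hsum]
  fin_cases σ
  · simpa [hre1] using sum_re_expect_momentumNumber_up hsec
  · simpa [hre1] using sum_re_expect_momentumNumber_down hsec

/-- **The raw budget.** For a normalised `(2n,0)`-sector ground state `ψ` of `hubbardTorus 2 L 1 U`
(`0 ≤ U`, `n ≤ L²`, `3 ≤ L`, `R ≤ L`) and a Fermi set `F` of `n` torus levels with a level `μ`: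
`Σ_a Σ_σ Σ_j |ε_j - μ| x^{aσ}_j(1-x^{aσ}_j) ≤ 2[R(R-1)G_L(μ) - L² G_R(μ)] - 2μnR + R(R-1)U L²`. [folklore] -/
theorem deviation_sum_le_raw (hL : 3 ≤ L) {R : ℕ} (hRL : R ≤ L) {U : ℝ} (hU : 0 ≤ U) {n : ℕ}
    (hn : n ≤ L ^ 2) {ψ : Fock (Orb (FermionTorus 2 L))}
    (hψ : IsGroundStateInSector (hubbardTorus 2 L 1 U) (2 * n) 0 ψ) (h1 : star ψ ⬝ᵥ ψ = 1)
    (F : Finset (TorusSite 2 L)) (hFc : F.card = n) (μ : ℝ)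
    (hF : ∀ k ∈ F, torusBand L k ≤ μ) (hF' : ∀ k ∉ F, μ ≤ torusBand L k) :
    ∑ a : TorusSite 2 L, ∑ σ : Fin 2, ∑ j : Fin 2 → Fin R,
        |torusBand (2 * R + 2) (blockMomentum R j) - μ| *
        ((star ψ ⬝ᵥ (numberMode (Function.extend
          (fun u : Fin 2 → Fin R => orb (FermionTorus.ofTorusSite (a + fun i => ((u i : ℕ) : ZMod L))) σ)
          (fun u => ((blockMode R j u : ℝ) : ℂ)) 0) *ᵥ ψ)).re *
         (1 - (star ψ ⬝ᵥ (numberMode (Function.extend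
          (fun u : Fin 2 → Fin R => orb (FermionTorus.ofTorusSite (a + fun i => ((u i : ℕ) : ZMod L))) σ)
          (fun u => ((blockMode R j u : ℝ) : ℂ)) 0) *ᵥ ψ)).re)) ≤
      2 * ((R : ℝ) * (R - 1) * ∑ k : TorusSite 2 L, min (torusBand L k - μ) 0 -
          (L : ℝ) ^ 2 * ∑ j : Fin 2 → Fin R, min (torusBand (2 * R + 2) (blockMomentum R j) - μ) 0) -
        2 * μ * n * R + (R : ℝ) * (R - 1) * U * (L : ℝ) ^ 2 := by
  have hL' : 2 < L := by omega
  -- sum the block bathtub inequalities over `a` and `σ`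
  have hbath := fun a σ => block_bathtub a hRL μ ψ h1 σ (R := R)
  -- the right-hand side: `Σ_a Σ_σ (-Re⟨T_{aσ}⟩) = R(R-1) Re⟨ψ, H₀ ψ⟩`
  have hhop : ∀ σ : Fin 2, ∑ a : TorusSite 2 L, (star ψ ⬝ᵥ ((∑ u : Fin 2 → Fin R, ∑ v : Fin 2 → Fin R,
        (((∑ e ∈ unitSteps, if (∀ i, ((v i : ℕ) : ℤ) = ((u i : ℕ) : ℤ) + e i) then (1 : ℝ) else 0
          : ℝ) : ℂ)) •
          (creation (orb (FermionTorus.ofTorusSite (a + fun i => ((u i : ℕ) : ZMod L))) σ) *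
            annihilation (orb (FermionTorus.ofTorusSite (a + fun i => ((v i : ℕ) : ZMod L))) σ) :
              Matrix (Finset (Orb (FermionTorus 2 L))) (Finset (Orb (FermionTorus 2 L))) ℂ)) *ᵥ ψ)).re =
      ((R * (R - 1) : ℕ) : ℝ) * (star ψ ⬝ᵥ ((∑ x : TorusSite 2 L, ∑ e ∈ unitSteps,
        creation (orb (FermionTorus.ofTorusSite x) σ) *
          annihilation (orb (FermionTorus.ofTorusSite (x + Torus.proj L e)) σ) :
            Matrix (Finset (Orb (FermionTorus 2 L))) _ ℂ) *ᵥ ψ)).re := by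
    intro σ
    rw [← Complex.re_sum, ← dotProduct_sum, ← Matrix.sum_mulVec, sum_corner_blockHopping_eq R σ,
      ← Nat.cast_smul_eq_nsmul ℂ, Matrix.smul_mulVec, dotProduct_smul, smul_eq_mul,
      ← Complex.ofReal_natCast, Complex.re_ofReal_mul]
  have hH0 : (star ψ ⬝ᵥ (hubbardTorus 2 L 1 0 *ᵥ ψ)).re =
      -∑ σ : Fin 2, (star ψ ⬝ᵥ ((∑ x : TorusSite 2 L, ∑ e ∈ unitSteps,
        creation (orb (FermionTorus.ofTorusSite x) σ) *
          annihilation (orb (FermionTorus.ofTorusSite (x + Torus.proj L e)) σ) :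
            Matrix (Finset (Orb (FermionTorus 2 L))) _ ℂ) *ᵥ ψ)).re := by
    rw [Summit.HubbardSuperconductivity.EnslavedA1g.hubbardTorus_eq_sum_unitSteps L hL' 1 0]
    simp only [Complex.ofReal_one, Complex.ofReal_zero, zero_smul, add_zero, neg_smul, one_smul,
      neg_mulVec, dotProduct_neg, Complex.neg_re, Matrix.sum_mulVec, dotProduct_sum, Complex.re_sum]
    congr 1
    conv_rhs => rw [Finset.sum_comm]
    refine Finset.sum_congr rfl fun x _ => ?_
    exact Finset.sum_comm
  -- the number terms: `Σ_a Σ_σ Σ_u Re⟨n_{a+u,σ}⟩ = R² · 2n`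
  have hnum : ∀ σ : Fin 2, ∑ a : TorusSite 2 L, ∑ u : Fin 2 → Fin R, (star ψ ⬝ᵥ ((numberOp
      (FermionTorus.ofTorusSite (a + fun i => ((u i : ℕ) : ZMod L))) σ :
        Matrix (Finset (Orb (FermionTorus 2 L))) _ ℂ) *ᵥ ψ)).re = ((R ^ 2 : ℕ) : ℝ) * n := by
    intro σ
    have h := congrArg (fun M : Matrix (Finset (Orb (FermionTorus 2 L))) _ ℂ => (star ψ ⬝ᵥ (M *ᵥ ψ)).re)
      (sum_corner_blockNumber_eq (L := L) R σ)
    rw [← Nat.cast_smul_eq_nsmul ℂ, Matrix.smul_mulVec, dotProduct_smul, smul_eq_mul,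
      ← Complex.ofReal_natCast, Complex.re_ofReal_mul] at h
    simp only [Matrix.sum_mulVec, dotProduct_sum, Complex.re_sum] at h
    rw [sum_re_expect_numberOp_ofTorusSite hψ.1 h1 σ] at h
    exact h
  -- the kinetic budget of the tree
  have hbud := re_expect_hubbardTorus_zero_le_of_groundStateInSector hU hn hψ h1
  rw [← hFc] at hbud
  rw [minEnergyOn_szSector_free_eq hL F μ hF hF', sum_fermiSet_eq_gcSum_add (torusBand L) F μ hF hF',
    hFc] at hbud
  -- assemble through the abstract summation step
  have key := sum_budget_abstract
    (∑ j : Fin 2 → Fin R, min (torusBand (2 * R + 2) (blockMomentum R j) - μ) 0) μ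
    (fun (a : TorusSite 2 L) (σ : Fin 2) => ∑ u : Fin 2 → Fin R, (star ψ ⬝ᵥ ((numberOp
      (FermionTorus.ofTorusSite (a + fun i => ((u i : ℕ) : ZMod L))) σ :
        Matrix (Finset (Orb (FermionTorus 2 L))) _ ℂ) *ᵥ ψ)).re)
    (fun (a : TorusSite 2 L) (σ : Fin 2) => ∑ j : Fin 2 → Fin R,
        |torusBand (2 * R + 2) (blockMomentum R j) - μ| *
        ((star ψ ⬝ᵥ (numberMode (Function.extend
          (fun u : Fin 2 → Fin R => orb (FermionTorus.ofTorusSite (a + fun i => ((u i : ℕ) : ZMod L))) σ)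
          (fun u => ((blockMode R j u : ℝ) : ℂ)) 0) *ᵥ ψ)).re *
         (1 - (star ψ ⬝ᵥ (numberMode (Function.extend
          (fun u : Fin 2 → Fin R => orb (FermionTorus.ofTorusSite (a + fun i => ((u i : ℕ) : ZMod L))) σ)
          (fun u => ((blockMode R j u : ℝ) : ℂ)) 0) *ᵥ ψ)).re)))
    (fun (a : TorusSite 2 L) (σ : Fin 2) => (star ψ ⬝ᵥ ((∑ u : Fin 2 → Fin R, ∑ v : Fin 2 → Fin R,
        (((∑ e ∈ unitSteps, if (∀ i, ((v i : ℕ) : ℤ) = ((u i : ℕ) : ℤ) + e i) then (1 : ℝ) else 0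
          : ℝ) : ℂ)) •
          (creation (orb (FermionTorus.ofTorusSite (a + fun i => ((u i : ℕ) : ZMod L))) σ) *
            annihilation (orb (FermionTorus.ofTorusSite (a + fun i => ((v i : ℕ) : ZMod L))) σ) :
              Matrix (Finset (Orb (FermionTorus 2 L))) (Finset (Orb (FermionTorus 2 L))) ℂ)) *ᵥ ψ)).re)
    (fun a σ => hbath a σ)
  beta_reduce at key
  simp only [hhop, hnum, card_torusSite, Fintype.card_fin, Finset.sum_const, Finset.card_univ,
    nsmul_eq_mul] at key
  have hcast : ((R * (R - 1) : ℕ) : ℝ) = (R : ℝ) * (R - 1) := by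
    rcases Nat.eq_zero_or_pos R with rfl | hR
    · simp
    · rw [Nat.cast_mul, Nat.cast_sub hR]; simp
  rw [hcast] at key
  push_cast at key hbud ⊢
  have hkin : ∑ σ : Fin 2, (R : ℝ) * (R - 1) * (star ψ ⬝ᵥ ((∑ x : TorusSite 2 L, ∑ e ∈ unitSteps,
        creation (orb (FermionTorus.ofTorusSite x) σ) *
          annihilation (orb (FermionTorus.ofTorusSite (x + Torus.proj L e)) σ) :
            Matrix (Finset (Orb (FermionTorus 2 L))) _ ℂ) *ᵥ ψ)).re =
      -((R : ℝ) * (R - 1) * (star ψ ⬝ᵥ (hubbardTorus 2 L 1 0 *ᵥ ψ)).re) := by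
    rw [← Finset.mul_sum, hH0]; ring
  have hRR : (0 : ℝ) ≤ (R : ℝ) * (R - 1) := by
    rcases Nat.eq_zero_or_pos R with rfl | hR
    · simp
    · exact mul_nonneg (Nat.cast_nonneg _) (by
        have : (1 : ℝ) ≤ R := by exact_mod_cast hR
        linarith)
  have hmul := mul_le_mul_of_nonneg_left hbud hRR
  linarith [key, hkin, hmul]

/-- `|G_L(μ)| ≤ 8 L²` for `|μ| ≤ 4` (the band lies in `[-4,4]`). [folklore] -/
theorem abs_gcBandSum_le (μ : ℝ) (hμ : μ ∈ Set.Icc (-4 : ℝ) 4) :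
    |∑ k : TorusSite 2 L, min (torusBand L k - μ) 0| ≤ 8 * (L : ℝ) ^ 2 := by
  refine (Finset.abs_sum_le_sum_abs _ _).trans ?_
  calc ∑ k : TorusSite 2 L, |min (torusBand L k - μ) 0| ≤ ∑ _k : TorusSite 2 L, (8 : ℝ) := by
        refine Finset.sum_le_sum fun k _ => ?_
        have h4 := torusBand_le_four L k
        have h4' := neg_four_le_torusBand L k
        rw [abs_le]
        constructor
        · rcases le_or_gt (torusBand L k - μ) 0 with hle | hgt
          · rw [min_eq_left hle]; linarith [hμ.2]
          · rw [min_eq_right hgt.le]; norm_num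
        · exact (min_le_right _ _).trans (by norm_num)
    _ = 8 * (L : ℝ) ^ 2 := by
        rw [Finset.sum_const, Finset.card_univ, card_torusSite, nsmul_eq_mul]
        push_cast; ring

/-- **The deviation budget.** For `1 ≤ R`, `2R + 2 ≤ L`, `0 ≤ U`, `n ≤ L²` and a normalised
`(2n, 0)`-sector ground state `ψ` of `hubbardTorus 2 L 1 U`, there is a level `μ ∈ [-4,4]` with
`Σ_a Σ_σ Σ_j |ε_j - μ| x^{aσ}_j (1 - x^{aσ}_j) ≤ L² R² (U + (72 + 32π)/R)`. [folklore] -/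
theorem deviationBudget {R : ℕ} (hR : 1 ≤ R) (hRL : 2 * R + 2 ≤ L) {U : ℝ} (hU : 0 ≤ U) {n : ℕ}
    (hn : n ≤ L ^ 2) {ψ : Fock (Orb (FermionTorus 2 L))}
    (hψ : IsGroundStateInSector (hubbardTorus 2 L 1 U) (2 * n) 0 ψ) (h1 : star ψ ⬝ᵥ ψ = 1) :
    ∃ μ ∈ Set.Icc (-4 : ℝ) 4,
      ∑ a : TorusSite 2 L, ∑ σ : Fin 2, ∑ j : Fin 2 → Fin R,
        |torusBand (2 * R + 2) (blockMomentum R j) - μ| *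
        ((star ψ ⬝ᵥ (numberMode (Function.extend
          (fun u : Fin 2 → Fin R => orb (FermionTorus.ofTorusSite (a + fun i => ((u i : ℕ) : ZMod L))) σ)
          (fun u => ((blockMode R j u : ℝ) : ℂ)) 0) *ᵥ ψ)).re *
         (1 - (star ψ ⬝ᵥ (numberMode (Function.extend
          (fun u : Fin 2 → Fin R => orb (FermionTorus.ofTorusSite (a + fun i => ((u i : ℕ) : ZMod L))) σ)
          (fun u => ((blockMode R j u : ℝ) : ℂ)) 0) *ᵥ ψ)).re)) ≤
      (L : ℝ) ^ 2 * (R : ℝ) ^ 2 * (U + (72 + 32 * Real.pi) / R) := by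
  have hL : 3 ≤ L := by omega
  have hRL' : R ≤ L := by omega
  haveI : NeZero (2 * R + 2) := ⟨by omega⟩
  -- a Fermi set and a clamped Fermi level
  have hn' : n ≤ Fintype.card (TorusSite 2 L) := by rw [card_torusSite]; exact hn
  obtain ⟨F, eF, hFc, hF, hF'⟩ := exists_fermiSet (torusBand L) hn'
  obtain ⟨μ, hμ, hFμ, hFμ'⟩ := exists_clamped_fermiLevel F eF hF hF'
  refine ⟨μ, hμ, ?_⟩
  have raw := deviation_sum_le_raw hL hRL' hU hn hψ h1 F hFc μ hFμ hFμ' (R := R)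
  -- the grand-canonical comparisons
  have h1' := gcBandSum_le_four_mul_blockSum R μ
  have h2' := gcBandSum_div_sq_ge_of_refine L (2 * R + 2) μ
  have h3' := abs_gcBandSum_le (L := L) μ hμ
  have hRr : (1 : ℝ) ≤ R := by exact_mod_cast hR
  have hRLr : 2 * (R : ℝ) + 2 ≤ L := by exact_mod_cast hRL
  push_cast at h2'
  have arith := budget_arith hRr hRLr h1' h2' h3'
  have hnr : (n : ℝ) ≤ (L : ℝ) ^ 2 := by exact_mod_cast hn
  have hLpos : (0 : ℝ) < L := by
    have : (3 : ℝ) ≤ L := by exact_mod_cast hL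
    linarith
  have hRpos : (0 : ℝ) < R := by linarith
  -- bookkeeping
  have e1 : (L : ℝ) ^ 2 * (R : ℝ) ^ 2 * (U + (72 + 32 * Real.pi) / R) =
      (L : ℝ) ^ 2 * (R : ℝ) ^ 2 * U + (72 + 32 * Real.pi) * (L : ℝ) ^ 2 * R := by
    field_simp
  rw [e1]
  have hμn : -(2 * μ * n * R) ≤ 8 * (L : ℝ) ^ 2 * R := by
    have hμ4 : -μ ≤ 4 := by linarith [hμ.1]
    nlinarith [mul_nonneg (Nat.cast_nonneg n) hRpos.le, mul_le_mul_of_nonneg_right hnr hRpos.le]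
  have hUterm : (R : ℝ) * (R - 1) * U * (L : ℝ) ^ 2 ≤ (L : ℝ) ^ 2 * (R : ℝ) ^ 2 * U := by
    nlinarith [mul_nonneg (mul_nonneg hRpos.le hU) (sq_nonneg (L : ℝ))]
  linarith [raw, arith, hμn, hUterm, Real.pi_pos]

/-! ### Registered stub (supports stmt-HubbardSuperconductivity-18534) -/

/-- Registered stub `stub_coarseDeviationBudget`: the deviation budget in closed form. [folklore] -/
theorem stub_coarseDeviationBudget :
    ∀ (L : ℕ) [NeZero L] (R : ℕ), 1 ≤ R → 2 * R + 2 ≤ L → ∀ (U : ℝ), 0 ≤ U → ∀ (n : ℕ), n ≤ L ^ 2 → ∀ (ψ : Fock (Orb (FermionTorus 2 L))), IsGroundStateInSector (hubbardTorus 2 L 1 U) (2 * n) 0 ψ → star ψ ⬝ᵥ ψ = 1 → ∃ μ ∈ Set.Icc (-4 : ℝ) 4, (∑ a : TorusSite 2 L, ∑ σ : Fin 2, ∑ j : Fin 2 → Fin R, |torusBand (2 * R + 2) (blockMomentum R j) - μ| * ((star ψ ⬝ᵥ (numberMode (Function.extend (fun u : Fin 2 → Fin R => orb (FermionTorus.ofTorusSite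 (a + fun i => ((u i : ℕ) : ZMod L))) σ) (fun u => ((blockMode R j u : ℝ) : ℂ)) 0) *ᵥ ψ)).re * (1 - (star ψ ⬝ᵥ (numberMode (Function.extend (fun u : Fin 2 → Fin R => orb (FermionTorus.ofTorusSite (a + fun i => ((u i : ℕ) : ZMod L))) σ) (fun u => ((blockMode R j u : ℝ) : ℂ)) 0) *ᵥ ψ)).re))) ≤ (L : ℝ) ^ 2 * (R : ℝ) ^ 2 * (U + (72 + 32 * Real.pi) / R) :=
  fun _ _ _ hR hRL _ hU _ hn _ hψ h1 => deviationBudget hR hRL hU hn hψ h1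

end Sum

end Summit.HubbardSuperconductivity.HubbardSuperconductivity.Theorems.CoarseTightness

end
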